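import Literature.IUT.HodgeArakelov.ThetaEvaluationSettingCor23Bridge
import Literature.IUT.HodgeArakelov.SubgraphReferenceGaloisSurjective
import HarnessLib

/-!
# [IUTchII] Prop. 1.4 / Prop. 2.2 (i): `Π_Ÿ(Π) ⊴ Π` is FORCED by the interface — the normality input of the
# Prop. 2.2 (i)′ closers discharged for EVERY `EtaleThetaData` (proof-only)

Proof-only companion (abc-iut cell, wave W6, seat abc-iut-w6-d005; cone of [IUTchIII] Cor. 3.12, DAG node
**IUTchII:Prop2.2(i)**, tranche row d005). No definition, no new named fact; the audited modules
`MonoThetaFromGroups.lean` (abc-iut-L6-t1, `EtaleThetaData`), `ThetaEvaluationSetting*.lean`,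
`SubgraphReferenceGaloisSurjective.lean` are imported unchanged. Nothing here takes a side on [IUTchIII] Cor. 3.12
(claim key `Mochizuki2012`, DISPUTED, D-0012); typed ≠ proved.

S. Mochizuki, *Inter-universal Teichmüller theory II*, kurims manuscript (Dec. 2020): §1 Prop. 1.4 p. 27
("`Π_Ÿ(Π) ⊆ Π` … the open subgroup corresponding to the tempered covering `Ÿ`"), §2 Rmk. 2.1.1 (i) p. 65 (the
natural exact sequence `1 → Gal(Ÿ̲_v/Y̲_v) → Gal(Ÿ̲_v/X̲̲_v) → Gal(Y̲_v/X̲̲_v) → 1`: `Ÿ̲_v → X̲̲_v` is Galois), §2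
Prop. 2.2 (i) p. 66.

THE POINT. abc-iut-L6-t1's interface `EtaleThetaData S Π` records "corresponding to the tempered covering `Ÿ`" as
the clause `PiYdd_corresponds : ∀ e : Π ≃ₜ* Π^tp_{X̲̲_k}, e(Π_Ÿ(Π)) = Π^tp_{Ÿ̲_k}` — for EVERY isomorphism of
topological groups. Applying it to `e` and to `α ≫ e` shows that `Π_Ÿ(Π)` is carried onto itself by every
automorphism `α` of the topological group `Π` (the `Π`-side twin of abc-iut-L6-t1's `map_piYddRef_eq`,
MonoThetaFromGroupsProofs3), in particular by every inner automorphism: **`Π_Ÿ(Π)` is normal in `Π` for every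
datum of the interface**, not only at the model (abc-iut-L6-t1 `EtaleThetaDataOfSetting.piYdd_normal`, p411758).
Consequently the hypothesis `hN : D.PiYdd.Normal` of the Prop. 2.2 (i)′ closers
`prop22_i'_of_groupTheoretic` (abc-iut-w4-d010, p412492), `prop22_i'_of_cor23iii` (abc-iut-w4-d034, p413706),
`prop22_i'_of_cor23iii_bridge` / `prop22_i'_of_outer_bridge` (abc-iut-w5-d086, p413787) is DISCHARGED at the
interface level: the versions below take `R.GroupTheoretic` (FACT-LIST F-1782, the [SemiAnbd] Cor. 3.11 input of
the printed proof), the [IUTchI] Cor. 2.3 (iii) input and the identification binders ONLY.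

Results (namespace `Literature.IUT.HodgeArakelov`):
* `EtaleThetaData.map_piYdd_eq` — `α(Π_Ÿ(Π)) = Π_Ÿ(Π)` for every `α : Π ≃ₜ* Π`;
* `EtaleThetaData.piYdd_normal` — `Π_Ÿ(Π) ⊴ Π`;
* `prop22_i'_of_groupTheoretic_of_surj`, `prop22_i'_of_cor23iii_of_ident`, `prop22_i'_of_cor23iii_bridge_of_ident`,
  `prop22_i'_of_outer_bridge_of_ident` — the four closers with `hN` removed.
-/

namespace Literature.IUT.HodgeArakelov

universe u

open Literature.IUT.HodgeTheaters
open scoped Pointwise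

namespace EtaleThetaData

variable {S₀ : ThetaSetting.{u}} {P : TopGroup.{u}}

/-- **`Π_Ÿ(Π)` is characteristic in the topological group `Π`**: every automorphism `α` of the topological
group `Π` carries `Π_Ÿ(Π)` onto itself — apply the interface clause `PiYdd_corresponds` ("corresponding to the
tempered covering `Ÿ`", [IUTchII] Prop. 1.4 p. 27) to a reference isomorphism `e` and to `α ≫ e`, and cancel
`e`. [claim: Mochizuki2012, status: disputed] (IUTchII §1 Prop 1.4, kurims p.27) -/
theorem map_piYdd_eq (X : EtaleThetaData S₀ P) (α : P ≃ₜ* P) :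
    X.PiYdd.map α.toMulEquiv.toMonoidHom = X.PiYdd := by
  obtain ⟨e⟩ := X.isoRef
  have h₁ := X.PiYdd_corresponds e
  have h₂ := X.PiYdd_corresponds (α.trans e)
  have hcomp : (α.trans e).toMulEquiv.toMonoidHom =
      e.toMulEquiv.toMonoidHom.comp α.toMulEquiv.toMonoidHom := rfl
  rw [hcomp, ← Subgroup.map_map, ← h₁] at h₂
  exact Subgroup.map_injective (f := e.toMulEquiv.toMonoidHom) e.injective h₂

/-- **`Π_Ÿ(Π) ⊴ Π` for EVERY datum of the interface** ([IUTchII] Rmk. 2.1.1 (i) p. 65: `Ÿ̲_v → X̲̲_v` is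
Galois; [EtTh] §2 p. 41): inner automorphisms are automorphisms of the topological group `Π`, so
`map_piYdd_eq` applies. This is the hypothesis `hN` of the Prop. 2.2 (i)′ closers, previously supplied only at
the model (`EtaleThetaDataOfSetting.piYdd_normal`). [claim: Mochizuki2012, status: disputed]
(IUTchII §2 Rmk 2.1.1 (i), kurims p.65) -/
theorem piYdd_normal (X : EtaleThetaData S₀ P) : X.PiYdd.Normal := by
  refine ⟨fun n hn g => ?_⟩
  -- conjugation by `g`, as an isomorphism of topological groups (a term, not a declaration)
  let c : P ≃ₜ* P :=
    { toFun := fun h => g * h * g⁻¹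
      invFun := fun h => g⁻¹ * h * g
      left_inv := fun h => by group
      right_inv := fun h => by group
      map_mul' := fun a b => by group
      continuous_toFun := (continuous_const.mul continuous_id).mul continuous_const
      continuous_invFun := (continuous_const.mul continuous_id).mul continuous_const }
  have h := X.map_piYdd_eq c
  rw [← h]
  exact ⟨n, hn, rfl⟩

end EtaleThetaData

variable {S : BadPlaceSetting.{u}} {P : TopGroup.{u}} {E : EnvOfGroup S.toThetaSetting P}

/-- **IUTchII:Prop2.2(i)′ from `GroupTheoretic` + `Π_{v•}·Δ = Π_v` ONLY** (abc-iut-w4-d010's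
`prop22_i'_of_groupTheoretic` with its normality hypothesis discharged by `EtaleThetaData.piYdd_normal`): for the
reference pair `R`, a Prop. 2.1 output `T`, a Prop. 1.4 output `D` with pointed inversion `ι₀`, the repaired
statement `Prop22_i' R T D ι₀` follows from `R.GroupTheoretic` (F-1782; [SemiAnbd] Cor. 3.11, proof p. 67) and the
surjection input `hsurj` (the decomposition group of the vertex `0` surjects onto the Galois group).
[claim: Mochizuki2012, status: disputed] (IUTchII §2 Prop 2.2 (i), kurims pp.66-67) -/
theorem prop22_i'_of_groupTheoretic_of_surj (R : SubgraphReference S) (T : TemperedCoverings S P)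
    (D : EtaleThetaData S.toThetaSetting P) (ι₀ : PointedInversion E D) (hG : R.GroupTheoretic)
    (hsurj : ∃ e₀ : P ≃ₜ* S.PiX, ∀ x : P, ∃ b : P, e₀ b ∈ R.refBullet ∧
      E.recon.projG (E.isoX b) = E.recon.projG (E.isoX x)) :
    Prop22_i' R T D ι₀ :=
  prop22_i'_of_groupTheoretic R T D ι₀ hG D.piYdd_normal hsurj

/-- **IUTchII:Prop2.2(i)′ ⟸ `GroupTheoretic` + [IUTchI] Cor. 2.3 (iii) BY NAME + identification** (abc-iut-w4-d034's
`prop22_i'_of_cor23iii`, p413706, with `hN` discharged): inputs `R.GroupTheoretic` (F-1782), an [IUTchI] §2 datum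
`D` of `X̲̲_v` at `ℍ = Γ•_X` with the typed `Cor23iii` under its hypothesis `Cor23Hyp` (abc-iut-L5-t1), and the
identification data `eD`, `hB`, `hker` of the MERGE-MAP row (reference pair ↔ decomposition groups).
[claim: Mochizuki2012, status: disputed] (IUTchII §2 Prop 2.2 (i), kurims pp.66-67; IUTchI §2 Cor 2.3 (iii), kurims p.47) -/
theorem prop22_i'_of_cor23iii_of_ident (R : SubgraphReference S) (T : TemperedCoverings S P)
    (D' : EtaleThetaData S.toThetaSetting P) (ι₀ : PointedInversion E D') (hG : R.GroupTheoretic)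
    (D : StableCurveTemperedData.{u}) (hH : D.Cor23Hyp) (h23 : D.Cor23iii)
    (eD : S.PiX ≃ₜ* D.PiTp) (hB : R.refBullet.map eD.toMulEquiv.toMonoidHom = D.piTpXH)
    (hker : ∀ z : S.PiX, S.aug z = 1 ↔ D.prTp (eD z) = 1) :
    Prop22_i' R T D' ι₀ :=
  prop22_i'_of_cor23iii R T D' ι₀ hG D'.piYdd_normal D hH h23 eD hB hker

/-- **IUTchII:Prop2.2(i)′ ⟸ `GroupTheoretic` + typed `Cor23iii` through the bridge identification** (abc-iut-w5-d086's
`prop22_i'_of_cor23iii_bridge`, p413787, with `hN` discharged): identification binders `j`, `e₀`, `hbullet`, `hker`.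
[claim: Mochizuki2012, status: disputed] (IUTchII §2 Prop 2.2 (i), kurims pp.66-67; IUTchI §2 Cor 2.3 (iii), kurims p.47) -/
theorem prop22_i'_of_cor23iii_bridge_of_ident (R : SubgraphReference S) (T : TemperedCoverings S P)
    (D' : EtaleThetaData S.toThetaSetting P) (ι₀ : PointedInversion E D') (hG : R.GroupTheoretic)
    (C : StableCurveTemperedData.{u}) (j : C.PiTp ≃ₜ* S.PiX) (e₀ : P ≃ₜ* S.PiX)
    (hbullet : R.refBullet = C.piTpXH.map j.toMulEquiv.toMonoidHom)
    (hker : ∀ y : P, E.recon.projG (E.isoX y) = 1 ↔ C.prTp (j.symm (e₀ y)) = 1)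
    (h23 : C.Cor23iii) (hyp : C.Cor23Hyp) :
    Prop22_i' R T D' ι₀ :=
  prop22_i'_of_cor23iii_bridge R T D' ι₀ hG D'.piYdd_normal C j e₀ hbullet hker h23 hyp

/-- **IUTchII:Prop2.2(i)′ ⟸ `GroupTheoretic` + the outer-descent form of [IUTchI] Cor. 2.3 (i)/(iii)** (abc-iut-w5-d086's
slimness-free `prop22_i'_of_outer_bridge`, p413787, with `hN` discharged): `hOut` = "`ℍ = Γ•_X` is `G_k`-stable"
([IUTchII] Rmk. 2.1.1 (ii): `Γ•_X` is `ι_X`-intrinsic), identification binders `j`, `e₀`, `hbullet`, `hker`.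
[claim: Mochizuki2012, status: disputed] (IUTchII §2 Prop 2.2 (i), kurims pp.66-67; IUTchI §2 Cor 2.3 (i)(iii), kurims p.47) -/
theorem prop22_i'_of_outer_bridge_of_ident (R : SubgraphReference S) (T : TemperedCoverings S P)
    (D' : EtaleThetaData S.toThetaSetting P) (ι₀ : PointedInversion E D') (hG : R.GroupTheoretic)
    (C : StableCurveTemperedData.{u}) (j : C.PiTp ≃ₜ* S.PiX) (e₀ : P ≃ₜ* S.PiX)
    (hbullet : R.refBullet = C.piTpXH.map j.toMulEquiv.toMonoidHom)
    (hker : ∀ y : P, E.recon.projG (E.isoX y) = 1 ↔ C.prTp (j.symm (e₀ y)) = 1)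
    (hOut : ∀ g : C.PiTp, ∃ d : C.DeltaTp, MulAut.conj g • (C.deltaTpH.map C.DeltaTp.subtype) =
      MulAut.conj (d : C.PiTp) • (C.deltaTpH.map C.DeltaTp.subtype)) :
    Prop22_i' R T D' ι₀ :=
  prop22_i'_of_outer_bridge R T D' ι₀ hG D'.piYdd_normal C j e₀ hbullet hker hOut

end Literature.IUT.HodgeArakelov
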